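import Summits.NavierStokesRegularity.NavierStokesRegularity.Theses.AxisymmetricExtremality
import Summits.NavierStokesRegularity.NavierStokesRegularity.Theorems.AxisymmetricExtremalityAxisymmetricKatoGlobalStubSereginLogSwirlOriginStep3LocalKeyEstimate
import Summits.NavierStokesRegularity.NavierStokesRegularity.Theorems.AxisymmetricExtremalityAxisymmetricKatoGlobalStubSereginLogSwirlOriginStep3LocalCutoff
import HarnessLib

/-!
# Seregin 2022, §2 Step 3: the key estimate for the Seregin–Zajaczkowski representative on the
# cylinder (the class the fact's core is stated in) — crux stmt-NavierStokesRegularity-15453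
# (`AxisymmetricExtremality.AxisymmetricKatoGlobal`), line registered, support for stub `stub_sereginLogSwirlOrigin`

Support file (`--supports stmt-NavierStokesRegularity-15453`; theorems only, everything proved)
toward the registered stub `stub_sereginLogSwirlOrigin` = the named fact
`Literature.Analysis.FluidPDE.seregin2022_logSwirl_regularAtOrigin` (G. Seregin, J. Math. Fluid
Mech. 24 (2022), Paper 27 = arXiv:2201.00153, §2). Composition of the two siblings
`…Step3LocalCutoff` (`cutoffFamily_package`: the cut-off globalisation `v = χV` of the
representative has smooth axisymmetric slices with uniform time moduli, agrees with `V` near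
`𝒞(ρ₀)`, is divergence free and solves the vorticity equation there) and `…Step3LocalKeyEstimate`
(`cutoff_energy_keyEstimate_local_of_moduli`):

* `cutoff_energy_keyEstimate_of_isSmoothAxisymmetricSolutionOn` (registered sub-goal) — **the
  Step-3 key estimate of Seregin 2022 for `(V, p)` in the class
  `IsSmoothAxisymmetricSolutionOn S V p` on an open `S ⊇ (a, b) × 𝒞(0, 1)`** (suitable weak
  solution on the open cylinder with `C^∞` slices and jointly continuous spatial derivatives —
  the smooth representative the first-singular-time reduction
  `seregin2022_logSwirl_regularAtOrigin_of_cleanRepr` provides; no time derivative of `V`, no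
  regular pressure), `ν = 1`: for the Step-1 cut-off `ζ = η³` (jointly smooth, axisymmetric,
  supported in `𝒞(ρ)`, `ρ < ρ₀ < ρ₁ < 1`) and `v = χV` with a smooth axisymmetric `χ = 1` on
  `𝒞(ρ₀)`, `tsupport χ ⊆ 𝒞(ρ₁)` (`exists_cylCutoff`; so `v = V` on `𝒞(ρ₀) ⊇ supp ζ`, and every
  quantity in the hypotheses and the conclusion is that of the solution there), under the
  hypotheses (2.2) (`|σ| ≤ C₁/ln³(e/r)`, `r < r₁`), the far-field bound `M`, the cut-off bound
  `Bcut`, the pointwise constants `P₀, …, P₄`, `|B̄(0,2)| ≤ V` and the smallness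
  `8C₁/ln(e/r₁) + 13C₁/ln²(e/r₁) + 4ε < 2ν` — all verbatim those of the classical
  `cutoff_energy_keyEstimate_unconditional`, stated for `v` — the conclusion
  `sup_{[t₁,t₂]}(∫(ζΓ)² + ∫(ζΦ)²) ≤ K`, `∫_{t₁}^{t₂}(∫|∇(ζΓ)|² + ∫|∇(ζΦ)|²) ≤ K/(2ν − 8C₁/L − (13C₁/L² + 4ε))`
  with the same constant `K`. This removes the class mismatch between the landed Step-3 chain
  and the core of the fact (arXiv p. 7: "the key estimate …
  `sup∫η⁶(|Γ|²+|Φ|²) + ∫∫(η³|∇Φ|)²+(η³|∇Γ|)² ≤ C(v,η,r₁)`", run on the singularity-free slab).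

## Mathlib / tree search

Tree: `cutoffFamily_package`, `exists_cylCutoff` (`…Step3LocalCutoff`),
`cutoff_energy_keyEstimate_local_of_moduli` (`…Step3LocalKeyEstimate`),
`SereginSverak2009.mem_spaceCyl`, `spaceCyl_subset_closedBall`, `continuous_cylRadius`.
`lean search 'keyEstimate_of_isSmoothAxisymmetricSolutionOn' --decl`: no matches (2026-08-17).

## References

* G. Seregin, J. Math. Fluid Mech. 24 (2022), Paper No. 27 = arXiv:2201.00153, §2 Steps 1, 3
  (arXiv pp. 5–7, the key estimate). [`Seregin2022LocalAxisym`]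
* G. Seregin, W. Zajaczkowski, SIAM J. Math. Anal. 39 (2007) 669–685, Prop. 4.1 (the class).
  [`SereginZajaczkowski2007`]
-/

noncomputable section

open MeasureTheory Set Filter Topology Function Metric intervalIntegral TopologicalSpace
open scoped ENNReal ContDiff Laplacian
open Literature.Analysis.FluidPDE Literature.Analysis.FluidPDE.SereginZajaczkowski2007

-- `<Problem> = <Summit>` duplicates a namespace component by design (lakefile sets the same option).
set_option linter.dupNamespace false

namespace Summit.NavierStokesRegularity.NavierStokesRegularity.Theorems.AxisymmetricKatoGlobal.EulerScaling

/-- The closed coordinate cylinder `{|x'| ≤ ρ, |x₃| ≤ ρ}` is compact, contains `𝒞(ρ)` and lies in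
`𝒞(ρ₀)` for `ρ < ρ₀ ≤ 1`. [folklore] -/
theorem closedCyl_props {ρ ρ₀ : ℝ} (h : ρ < ρ₀) (h1 : ρ₀ ≤ 1) :
    IsCompact {y : EuclideanSpace ℝ (Fin 3) | cylRadius y ≤ ρ ∧ |y 2| ≤ ρ} ∧
    SereginSverak2009.spaceCyl (0 : EuclideanSpace ℝ (Fin 3)) ρ ⊆ {y | cylRadius y ≤ ρ ∧ |y 2| ≤ ρ} ∧
    {y : EuclideanSpace ℝ (Fin 3) | cylRadius y ≤ ρ ∧ |y 2| ≤ ρ} ⊆ SereginSverak2009.spaceCyl 0 ρ₀ := by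
  have hsub : {y : EuclideanSpace ℝ (Fin 3) | cylRadius y ≤ ρ ∧ |y 2| ≤ ρ} ⊆ SereginSverak2009.spaceCyl 0 ρ₀ := by
    intro y hy
    have : cylRadius y < ρ₀ ∧ |y 2| < ρ₀ := ⟨hy.1.trans_lt h, hy.2.trans_lt h⟩
    simpa [SereginSverak2009.mem_spaceCyl] using this
  have hsub1 : SereginSverak2009.spaceCyl (0 : EuclideanSpace ℝ (Fin 3)) ρ₀ ⊆ SereginSverak2009.spaceCyl 0 1 := by
    intro y hy
    have hy' : cylRadius y < ρ₀ ∧ |y 2| < ρ₀ := by simpa [SereginSverak2009.mem_spaceCyl] using hy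
    have : cylRadius y < 1 ∧ |y 2| < 1 := ⟨hy'.1.trans_le h1, hy'.2.trans_le h1⟩
    simpa [SereginSverak2009.mem_spaceCyl] using this
  refine ⟨?_, fun y hy => ?_, hsub⟩
  · have hcl : IsClosed {y : EuclideanSpace ℝ (Fin 3) | cylRadius y ≤ ρ ∧ |y 2| ≤ ρ} :=
      (isClosed_le continuous_cylRadius continuous_const).inter
        (isClosed_le (contDiff_piLp_apply (𝕜 := ℝ) (p := 2) (n := 0) (i := (2 : Fin 3))).continuous.abs
          continuous_const)
    exact IsCompact.of_isClosed_subset (isCompact_closedBall _ _) hcl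
      ((hsub.trans hsub1).trans spaceCyl_subset_closedBall)
  · have hy' : cylRadius y < ρ ∧ |y 2| < ρ := by simpa [SereginSverak2009.mem_spaceCyl] using hy
    exact ⟨hy'.1.le, hy'.2.le⟩

/-- **Seregin 2022, §2 Step 3 — the key estimate for the Seregin–Zajaczkowski representative on
the cylinder** (`ν = 1`): for `(V, p)` with `IsSmoothAxisymmetricSolutionOn S V p`,
`S ⊇ (a, b) × 𝒞(0, 1)`, the cut-off globalisation `v = χV` (`χ = 1` on `𝒞(ρ₀)`,
`tsupport χ ⊆ 𝒞(ρ₁)`, `ρ₁ < 1`) and a cut-off `ζ` supported in `𝒞(ρ)`, `ρ < ρ₀`, the hypotheses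
and the conclusion of `cutoff_energy_keyEstimate_unconditional` stated for `v` (where `v = V`
near `supp ζ`). `cutoffFamily_package` + `cutoff_energy_keyEstimate_local_of_moduli` with
`K = {|x'| ≤ ρ, |x₃| ≤ ρ}`, `W = 𝒞(ρ₀)`, `R = 2`. Registered sub-goal toward
`stub_sereginLogSwirlOrigin`: it removes the class mismatch between the landed Step-3 chain and
the core of the fact. [cite: Seregin2022LocalAxisym, §2 Step 3 (arXiv:2201.00153 p. 7, the key estimate)] -/
theorem cutoff_energy_keyEstimate_of_isSmoothAxisymmetricSolutionOn : ∀ (S : TopologicalSpace.Opens (ℝ × EuclideanSpace ℝ (Fin 3))) (V v : ℝ → EuclideanSpace ℝ (Fin 3) → EuclideanSpace ℝ (Fin 3)) (p : ℝ → EuclideanSpace ℝ (Fin 3) → ℝ) (χ : EuclideanSpace ℝ (Fin 3) → ℝ) (ζ : ℝ → EuclideanSpace ℝ (Fin 3) → ℝ) (a b ν ρ ρ₀ ρ₁ t₁ t₂ C₁ r₁ M Bcut ε P₀ P₁ P₂ P₃ P₄ Vb : ℝ), SereginZajaczkowski2007.IsSmoothAxisymmetricSolutionOn S V p → Ioo a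 b ×ˢ SereginSverak2009.spaceCyl 0 1 ⊆ (S : Set (ℝ × EuclideanSpace ℝ (Fin 3))) → ν = 1 → 0 < ρ → ρ < ρ₀ → ρ₀ < ρ₁ → ρ₁ < 1 → ContDiff ℝ (⊤ : ℕ∞) χ → IsAxisymmetricScalar χ → (∀ y ∈ SereginSverak2009.spaceCyl 0 ρ₀, χ y = 1) → tsupport χ ⊆ SereginSverak2009.spaceCyl 0 ρ₁ → (∀ t, v t = fun y => χ y • V t y) → IsSmoothSpaceTimeOn (Ioo a b) ζ → (∀ s ∈ Ioo a b, IsAxisymmetricScalar (ζ s)) → (∀ s ∈ Ioo a b, tsupport (ζ s) ⊆ SereginSverak2009.spaceCyl 0 ρ) → Icc t₁ t₂ ⊆ Ioo a b → t₁ ≤ t₂ → 0 ≤ C₁ → 0 < r₁ → r₁ < 1 → 0 ≤ M → 0 ≤ Bcut → 0 < ε → 0 ≤ P₂ → volume.real (closedBall (0 : EuclideanSpace ℝ (Fin 3)) 2) ≤ Vb → (∀ t ∈ Icc t₁ t₂, ∀ x, 0 < cylRadius x → cylRadius x < r₁ → |swirl (v t) x| ≤ C₁ / Real.log (Real.exp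 1 / cylRadius x) ^ 3) → (∀ t ∈ Icc t₁ t₂, ∀ x, r₁ ≤ cylRadius x → |angVelQuot (v t) x * (ζ t x * angVortQuot (v t) x) * (ζ t x * radVelQuot (curl (v t)) x)| ≤ M) → (∀ t ∈ Icc t₁ t₂, (2 * (∫ x, ζ t x * timeDerivWithin (Ioo a b) ζ t x * angVortQuot (v t) x ^ 2) + 2 * (∫ x, ζ t x * angVortQuot (v t) x ^ 2 * fderiv ℝ (ζ t) x (v t x)) + 2 * ν * (∫ x, angVortQuot (v t) x ^ 2 * ‖fderiv ℝ (ζ t) x‖ ^ 2) - 4 * ν * (∫ x, ζ t x * angVortQuot (v t) x ^ 2 * radDerivQuot (ζ t) x)) + (2 * (∫ x, ζ t x * timeDerivWithin (Ioo a b) ζ t x * radVelQuot (curl (v t)) x ^ 2) + 2 * (∫ x, ζ t x * radVelQuot (curl (v t)) x ^ 2 * fderiv ℝ (ζ t) x (v t x)) + 2 * ν * (∫ x, radVelQuot (curl (v t)) x ^ 2 * ‖fderiv ℝ (ζ t) x‖ ^ 2) - 4 * ν * (∫ x, ζ t x * radVelQuot (curl (v t)) x ^ 2 * radDerivQuot (ζ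 t) x)) ≤ Bcut) → (∀ t ∈ Icc t₁ t₂, ∀ x, r₁ ≤ cylRadius x → |swirlVelocity (v t) x| * ‖fderiv ℝ (fun y => ζ t y * radVelQuot (v t) y) x‖ ≤ P₀) → (∀ t ∈ Icc t₁ t₂, ∀ x, |radVelQuot (v t) x| * |swirlVelocity (v t) x| * ‖fderiv ℝ (ζ t) x‖ ≤ P₁) → (∀ t ∈ Icc t₁ t₂, ∀ x, |ζ t x * radVelQuot (curl (v t)) x| * |swirlVelocity (v t) x| * (‖fderiv ℝ (ζ t) x‖ * ‖fderiv ℝ (radVelQuot (v t)) x‖) ≤ P₂) → (∀ t ∈ Icc t₁ t₂, ∀ x, fderiv ℝ (ζ t) x ≠ 0 → |fderiv ℝ (fun y => fderiv ℝ (ζ t) y (EuclideanSpace.single 2 1) * radVelQuot (v t) y - radDerivQuot (ζ t) y * v t y 2) x (EuclideanSpace.single 2 1)| ≤ P₃) → (∀ t ∈ Icc t₁ t₂, ∀ x, fderiv ℝ (ζ t) x ≠ 0 → |radDerivQuot (fun y => fderiv ℝ (ζ t) y (v t y)) x| ≤ P₄) → 8 * C₁ / Real.log (Real.exp 1 / r₁)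 + (13 * C₁ / Real.log (Real.exp 1 / r₁) ^ 2 + 4 * ε) < 2 * ν → (∀ t ∈ Icc t₁ t₂, (∫ x, (ζ t x * angVortQuot (v t) x) ^ 2) + (∫ x, (ζ t x * radVelQuot (curl (v t)) x) ^ 2) ≤ (∫ x, (ζ t₁ x * angVortQuot (v t₁) x) ^ 2) + (∫ x, (ζ t₁ x * radVelQuot (curl (v t₁)) x) ^ 2) + (Bcut + (12 * C₁ * (P₃ ^ 2 + P₄ ^ 2) * Vb / Real.log (Real.exp 1 / r₁) ^ 2 + ((P₀ ^ 2 + P₁ ^ 2) / (2 * ε) + 2 * P₂) * Vb) + 4 * M * Vb) * (t₂ - t₁)) ∧ ∫ s in t₁..t₂, ((∫ x, ‖fderiv ℝ (fun y => ζ s y * angVortQuot (v s) y) x‖ ^ 2) + (∫ x, ‖fderiv ℝ (fun y => ζ s y * radVelQuot (curl (v s)) y) x‖ ^ 2)) ≤ ((∫ x, (ζ t₁ x * angVortQuot (v t₁) x) ^ 2) + (∫ x, (ζ t₁ x * radVelQuot (curl (v t₁)) x) ^ 2) + (Bcut + (12 * C₁ * (P₃ ^ 2 + P₄ ^ 2)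 * Vb / Real.log (Real.exp 1 / r₁) ^ 2 + ((P₀ ^ 2 + P₁ ^ 2) / (2 * ε) + 2 * P₂) * Vb) + 4 * M * Vb) * (t₂ - t₁)) / (2 * ν - 8 * C₁ / Real.log (Real.exp 1 / r₁) - (13 * C₁ / Real.log (Real.exp 1 / r₁) ^ 2 + 4 * ε)) := by
  intro S V v p χ ζ a b ν ρ ρ₀ ρ₁ t₁ t₂ C₁ r₁ M Bcut ε P₀ P₁ P₂ P₃ P₄ Vc hV hsubS hν1 hρ hρρ₀ h₀₁ h₁ hχ hχax hχ1 hχs hv hζ hζax hζρ hsub h12 hC₁ hr₁ hr₁1 hM hBcut hε hP₂ hVc hσ hfar hcut hP0 hP1 hP2 hP3 hP4 hsmall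
  subst hν1
  have hI : IsOpen (Ioo a b) := isOpen_Ioo
  obtain ⟨hsm, hax, hR, hU, -, hdiv, hvort⟩ := cutoffFamily_package S V v p (Ioo a b) χ ρ₀ ρ₁ hV hI hsubS
    (hρ.trans hρρ₀) h₀₁ h₁ hχ hχax hχ1 hχs hv
  obtain ⟨hKc, hρK, hKW⟩ := closedCyl_props hρρ₀ (h₀₁.trans h₁).le
  have hsupp : ∀ s ∈ Ioo a b, ∀ x ∉ {y : EuclideanSpace ℝ (Fin 3) | cylRadius y ≤ ρ ∧ |y 2| ≤ ρ}, ζ s x = 0 :=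
    fun s hs x hx => image_eq_zero_of_notMem_tsupport fun h => hx (hρK (hζρ s hs h))
  have hζ1 : ∀ s ∈ Ioo a b, tsupport (ζ s) ⊆ SereginSverak2009.spaceCyl 0 1 := fun s hs =>
    ((hζρ s hs).trans hρK).trans (hKW.trans fun y hy => by
      have hy' : cylRadius y < ρ₀ ∧ |y 2| < ρ₀ := by simpa [SereginSverak2009.mem_spaceCyl] using hy
      have : cylRadius y < 1 ∧ |y 2| < 1 := ⟨hy'.1.trans (h₀₁.trans h₁), hy'.2.trans (h₀₁.trans h₁)⟩
      simpa [SereginSverak2009.mem_spaceCyl] using this)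
  have hvort' : ∀ s ∈ Ioo a b, ∀ x ∈ SereginSverak2009.spaceCyl (0 : EuclideanSpace ℝ (Fin 3)) ρ₀, cylRadius x ≠ 0 →
      HasDerivAt (fun s' => curl (v s') x) ((1 : ℝ) • (Δ (curl (v s))) x - fderiv ℝ (curl (v s)) x (v s x) +
        fderiv ℝ (v s) x (curl (v s) x)) s := fun s hs x hx _ => hvort s hs x hx
  exact cutoff_energy_keyEstimate_local_of_moduli a b 1 v ζ {y | cylRadius y ≤ ρ ∧ |y 2| ≤ ρ}
    (SereginSverak2009.spaceCyl 0 ρ₀) 2 t₁ t₂ C₁ r₁ M Bcut ε P₀ P₁ P₂ P₃ P₄ Vc hsm hax zero_le_one hζ hζax hζ1 hsub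
    hKc hsupp (SereginSverak2009.isOpen_spaceCyl 0 ρ₀) hKW hdiv hvort' hR hU h12 hC₁ hr₁ hr₁1 hM hBcut hε hP₂ hVc
    hσ hfar hcut hP0 hP1 hP2 hP3 hP4 hsmall

end Summit.NavierStokesRegularity.NavierStokesRegularity.Theorems.AxisymmetricKatoGlobal.EulerScaling

end
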